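import Summits.CriticalPhenomena.SAWScalingLimit.Theses.SAWDevelopingMap
import Summits.CriticalPhenomena.SAWScalingLimit.Theorems.SAWDevelopingMapInteriorFlatteningLiouvilleReduction
import Summits.CriticalPhenomena.SAWScalingLimit.Theorems.SAWDevelopingMapInteriorFlatteningLiouvilleLastExit
import Summits.CriticalPhenomena.SAWScalingLimit.Theorems.SAWDevelopingMapInteriorFlatteningLiouvillePicSubLocal
import Summits.CriticalPhenomena.SAWScalingLimit.Theorems.SAWDevelopingMapInteriorFlatteningLiouvilleEquivalence

/-!
# BIRTH skeleton for child 2 `LocalLimitsUnique` of the split of `InteriorFlattening` (stmt-CriticalPhenomena-8297)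

Redirect strategist r1 (`planner-cstrat-stmt-CriticalPhenomena-8297-r1-0`, 2026-08-17). BC3 material for the child once the split
`InteriorFlattening ⇐ BulkNoFold ∧ LocalLimitsUnique` is applied on route SAWDevelopingMap: ≥ 2 named stubs and a kernel-checked
composition `LocalLimitsUnique_of` concluding the CHILD TEXT (route vocabulary; definitionally `Liouville.LocalLimits.Subsingleton`).
The cut is the landed uniqueness reduction S7 (`stub_uniquenessReduction`, …LiouvilleReduction p110977) fed by the landed last-exit
factorisation S4 (`stub_lastExitFactorisation`, p104482) — the first strategist's recommended first crux-plan on this child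
(STRATEGY-CENSUS.md §Decomposition): the Liouville half = PICTURE-DOMAIN limits (far field removed) + WINDOWED far-field coherence +
WINDOWED intrusion tail, under the no-fold normalisation of the sibling child.

* `stub_bulkNoFold`            — = child 1 `BulkNoFold` (Defs form): the normalisation input for the lattice Harnack bound and the
                                  compactness at `O` (staffed separately as its own item; here only CONSUMED).
* `stub_pictureLimitsUnique`    — HARDEST: uniqueness of local limits of picture domains `B_S(O) ∖ intrusions` with receding features,
                                  under bulk no-fold ("W with the far field removed": the winding law of critical SAW inside a lattice
                                  ball from a boundary dart to the centre spreads with shape control). NECESSARY for the child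
                                  (`picLimits_subsingleton_of_localLimits_subsingleton`). OPEN.
* `stub_farFieldCoherence`      — windowed far-field coherence (depth window `B_{2S} ⊆ Λ ⊉ B_{4S}`): `Σ_P |amp P|·|m_S(P)| ≤ K|M(O)|`.
                                  Unwindowed form FALSE (ratio ≍ (depth/S)^{1/3}); windowed ⇐ atom `OneMouth.PhaseConcentration`. OPEN.
* `stub_intrusionTail`          — windowed intrusion tail: non-clean pictures carry `≤ δ` of the coherent mass. ⇐ atoms
                                  `PictureReentryGap ρ` + `OneMouth.CleanMonopoleLowerBound κ` (planar-SAW 3-arm separation). OPEN.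
* `LocalLimitsUnique_of`        — stub₁ → stub₂ → stub₃ → stub₄ → CHILD TEXT, by S7 ∘ S4 (no sorry).

Sorries: exactly the four `stub_*`. Probes to run at registration (BC3): each stub → child / → SAWScalingLimit must FAIL (stub 1 → child:
no landed implication, cf. `Probe_strong.lean` P8 for the stronger NoFoldBound; stubs 2–4 are each strictly partial inputs of S7).
-/

noncomputable section

open scoped BigOperators Classical Topology
open Filter Literature.Probability.LatticeModels Literature.Probability.RandomPlanarGeometry.SAW

namespace Summit.CriticalPhenomena.SAWScalingLimit.Cruxes.LocalLimitsUnique.Birth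

open Summit.CriticalPhenomena.SAWScalingLimit.Theorems.InteriorFlattening.Liouville

/-- **stub 1 — bulk no-fold (= sibling child `BulkNoFold`, Defs form; CONSUMED here).** Some `k < 1` bounds the Beltrami quotient at
every `R₀`-deep vertex, uniformly. Needed for: lattice Harnack at `O` (`Reduction.harnack_at_O`) and compactness at the origin. -/
theorem stub_bulkNoFold : ∃ k R₀ : ℝ, 0 ≤ k ∧ k < 1 ∧ RatioAtDepth R₀ k := by
  sorry

/-- **stub 2 — uniqueness of PICTURE-DOMAIN local limits under bulk no-fold (HARDEST; OPEN).** Local limits of the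
`m(O)`-normalised fields of good picture domains `B_{S_n}(O) ∖ P_n.1` (dart root on the sphere of radius `S_n ≥ n`, cleanliness
radius `≥ n`) coincide. The far field is absent by construction: this is the inner-response half of DCS's orientation-independence.
Why plausibly true: exact/MC numerics on balls (worst-root centre quotient 0.40 → 0.21 for R ≤ 4.6, 0.683 R^{-0.76} to R = 96, no
plateau); Koebe heuristic C/R. Size: open-problem. -/
theorem stub_pictureLimitsUnique :
    ∀ k R₀ : ℝ, 0 ≤ k → k < 1 → RatioAtDepth R₀ k → PicLimits.Subsingleton := by
  sorry

/-- **stub 3 — WINDOWED far-field coherence (OPEN; ⇐ `OneMouth.PhaseConcentration`).** In the depth window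
`B_{2S}(O) ⊆ Λ ⊉ B_{4S}(O)`, `S ≥ S₁`: the last-exit superposition does not amplify, `Σ_{P ∈ Pic S} |amp P| |m_S(P)| ≤ K |M(O)|`.
Why plausibly true: amplification ≤ 1.013 over 796 designed single-access interferometers and ≤ 1.09 over 1 600+ random far fields;
one contiguous contact arc in simply connected domains (landed p89024) forbids two-route cancellation. Size: L–open. -/
theorem stub_farFieldCoherence :
    ∃ K S₁ : ℝ, ∀ S : ℝ, S₁ ≤ S → ∀ (Λ : Finset HexVertex) (a : Sym2 HexVertex),
      hexDomainSimplyConnected Λ → a ∈ hexDomainBoundary Λ → Deep Λ O (2 * S) → ¬ Deep Λ O (4 * S) →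
        ∑ P ∈ Pic S, ‖amp Λ a S P‖ * ‖picMono S P‖ ≤ K * ‖obsMono Λ a‖ := by
  sorry

/-- **stub 4 — WINDOWED intrusion tail (OPEN; ⇐ `PictureReentryGap` + `OneMouth.CleanMonopoleLowerBound`).** In the same window,
pictures whose intrusions reach `B_{s̄}(O)` carry at most `δ` of the coherent mass on the inner edges of `B_r(O)`, for `S ≥ S₂(r, s̄, δ)`.
Why plausibly true: re-entering the inner ball after touching `B_S` costs a 3-arm event vs the 1-arm clean entrance (heuristic gap
`s^{-11/48}`); dirty prefixes measured 1–3 %. Size: L–open (no rigorous planar-SAW arm separation). -/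
theorem stub_intrusionTail :
    ∀ r : ℝ, 1 ≤ r → ∀ sbar : ℝ, r ≤ sbar → ∀ δ : ℝ, 0 < δ → ∃ S₂ : ℝ, ∀ S : ℝ, S₂ ≤ S →
      ∀ (Λ : Finset HexVertex) (a : Sym2 HexVertex),
        hexDomainSimplyConnected Λ → a ∈ hexDomainBoundary Λ → Deep Λ O (2 * S) → ¬ Deep Λ O (4 * S) →
          ∑ P ∈ (Pic S).filter (fun P => ¬ Clean sbar P),
              ‖amp Λ a S P‖ * ∑ e ∈ innerEdges r, ‖picField S P e‖ ≤
            δ * ∑ P ∈ Pic S, ‖amp Λ a S P‖ * ‖picMono S P‖ := by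
  sorry

/-- The child text (route vocabulary) is definitionally `LocalLimits.Subsingleton`. -/
theorem child_iff_defs :
    (let O : Literature.Probability.LatticeModels.HexVertex := ((0 : Literature.Probability.LatticeModels.Site 2), (0 : Fin 2)); let A : Literature.Probability.LatticeModels.HexVertex := ((0 : Literature.Probability.LatticeModels.Site 2), (1 : Fin 2)); let B : Literature.Probability.LatticeModels.HexVertex := ((-(Pi.single 0 1) : Literature.Probability.LatticeModels.Site 2), (1 : Fin 2)); let C : Literature.Probability.LatticeModels.HexVertex := ((-(Pi.single 1 1) : Literature.Probability.LatticeModels.Site 2), (1 : Fin 2)); let F : Finset Literature.Probability.LatticeModels.HexVertex → Sym2 Literature.Probability.LatticeModels.HexVertex → Sym2 Literature.Probability.LatticeModels.HexVertex → ℂ := fun Λ a z => Literature.Probability.RandomPlanarGeometry.SAW.hexParafermionicObservable Λ a Literature.Probability.RandomPlanarGeometry.SAW.hexCriticalFugacity (5 / 8) z; let M : Finset Literature.Probability.LatticeModels.HexVertex → Sym2 Literature.Probability.LatticeModels.HexVertex → ℂ := fun Λ a => F Λ a s(O, A) + F Λ a s(O, B) + F Λ a s(O, C); let LocalLimits : Set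 (Sym2 Literature.Probability.LatticeModels.HexVertex → ℂ) := {G | (∀ z : Sym2 Literature.Probability.LatticeModels.HexVertex, z ∉ Literature.Probability.LatticeModels.hexGraph.edgeSet → G z = 0) ∧ ∃ (Λ : ℕ → Finset Literature.Probability.LatticeModels.HexVertex) (a : ℕ → Sym2 Literature.Probability.LatticeModels.HexVertex), (∀ n : ℕ, Literature.Probability.RandomPlanarGeometry.SAW.hexDomainSimplyConnected (Λ n) ∧ a n ∈ Literature.Probability.RandomPlanarGeometry.SAW.hexDomainBoundary (Λ n) ∧ ∀ w : Literature.Probability.LatticeModels.HexVertex, dist (Literature.Probability.LatticeModels.hexCenter w) (Literature.Probability.LatticeModels.hexCenter O) ≤ (n : ℝ) → w ∈ Λ n) ∧ (∀ n : ℕ, M (Λ n) (a n) ≠ 0) ∧ ∀ z ∈ Literature.Probability.LatticeModels.hexGraph.edgeSet, Filter.Tendsto (fun n : ℕ => F (Λ n) (a n) z / M (Λ n) (a n)) Filter.atTop (nhds (G z))}; LocalLimits.Subsingleton) ↔ LocalLimits.Subsingleton :=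
  Iff.rfl

/-- **COMPOSITION — the four stubs give the CHILD TEXT** (S7 `stub_uniquenessReduction` fed by S4 `stub_lastExitFactorisation`,
both landed; no sorry here). -/
theorem LocalLimitsUnique_of
    (h₁ : ∃ k R₀ : ℝ, 0 ≤ k ∧ k < 1 ∧ RatioAtDepth R₀ k)
    (h₂ : ∀ k R₀ : ℝ, 0 ≤ k → k < 1 → RatioAtDepth R₀ k → PicLimits.Subsingleton)
    (h₃ : ∃ K S₁ : ℝ, ∀ S : ℝ, S₁ ≤ S → ∀ (Λ : Finset HexVertex) (a : Sym2 HexVertex),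
      hexDomainSimplyConnected Λ → a ∈ hexDomainBoundary Λ → Deep Λ O (2 * S) → ¬ Deep Λ O (4 * S) →
        ∑ P ∈ Pic S, ‖amp Λ a S P‖ * ‖picMono S P‖ ≤ K * ‖obsMono Λ a‖)
    (h₄ : ∀ r : ℝ, 1 ≤ r → ∀ sbar : ℝ, r ≤ sbar → ∀ δ : ℝ, 0 < δ → ∃ S₂ : ℝ, ∀ S : ℝ, S₂ ≤ S →
      ∀ (Λ : Finset HexVertex) (a : Sym2 HexVertex),
        hexDomainSimplyConnected Λ → a ∈ hexDomainBoundary Λ → Deep Λ O (2 * S) → ¬ Deep Λ O (4 * S) →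
          ∑ P ∈ (Pic S).filter (fun P => ¬ Clean sbar P),
              ‖amp Λ a S P‖ * ∑ e ∈ innerEdges r, ‖picField S P e‖ ≤
            δ * ∑ P ∈ Pic S, ‖amp Λ a S P‖ * ‖picMono S P‖) :
    (let O : Literature.Probability.LatticeModels.HexVertex := ((0 : Literature.Probability.LatticeModels.Site 2), (0 : Fin 2)); let A : Literature.Probability.LatticeModels.HexVertex := ((0 : Literature.Probability.LatticeModels.Site 2), (1 : Fin 2)); let B : Literature.Probability.LatticeModels.HexVertex := ((-(Pi.single 0 1) : Literature.Probability.LatticeModels.Site 2), (1 : Fin 2)); let C : Literature.Probability.LatticeModels.HexVertex := ((-(Pi.single 1 1) : Literature.Probability.LatticeModels.Site 2), (1 : Fin 2)); let F : Finset Literature.Probability.LatticeModels.HexVertex → Sym2 Literature.Probability.LatticeModels.HexVertex → Sym2 Literature.Probability.LatticeModels.HexVertex → ℂ := fun Λ a z => Literature.Probability.RandomPlanarGeometry.SAW.hexParafermionicObservable Λ a Literature.Probability.RandomPlanarGeometry.SAW.hexCriticalFugacity (5 / 8) z; let M : Finset Literature.Probability.LatticeModels.HexVertex → Sym2 Literature.Probability.LatticeModels.HexVertex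 → ℂ := fun Λ a => F Λ a s(O, A) + F Λ a s(O, B) + F Λ a s(O, C); let LocalLimits : Set (Sym2 Literature.Probability.LatticeModels.HexVertex → ℂ) := {G | (∀ z : Sym2 Literature.Probability.LatticeModels.HexVertex, z ∉ Literature.Probability.LatticeModels.hexGraph.edgeSet → G z = 0) ∧ ∃ (Λ : ℕ → Finset Literature.Probability.LatticeModels.HexVertex) (a : ℕ → Sym2 Literature.Probability.LatticeModels.HexVertex), (∀ n : ℕ, Literature.Probability.RandomPlanarGeometry.SAW.hexDomainSimplyConnected (Λ n) ∧ a n ∈ Literature.Probability.RandomPlanarGeometry.SAW.hexDomainBoundary (Λ n) ∧ ∀ w : Literature.Probability.LatticeModels.HexVertex, dist (Literature.Probability.LatticeModels.hexCenter w) (Literature.Probability.LatticeModels.hexCenter O) ≤ (n : ℝ) → w ∈ Λ n) ∧ (∀ n : ℕ, M (Λ n) (a n) ≠ 0) ∧ ∀ z ∈ Literature.Probability.LatticeModels.hexGraph.edgeSet, Filter.Tendsto (fun n : ℕ => F (Λ n) (a n) z / M (Λ n) (a n)) Filter.atTop (nhds (G z))}; LocalLimits.Subsingleton) := by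
  obtain ⟨k, R₀, hk0, hk1, hR⟩ := h₁
  exact child_iff_defs.2
    (stub_uniquenessReduction stub_lastExitFactorisation h₃ h₄ k R₀ hk0 hk1 hR (h₂ k R₀ hk0 hk1 hR))

/-- The child is NECESSARY for stub 2's conclusion-class: child ⇒ picture limits coincide (…PicSubLocal). -/
theorem picLimits_subsingleton_of_child (h : let O : Literature.Probability.LatticeModels.HexVertex := ((0 : Literature.Probability.LatticeModels.Site 2), (0 : Fin 2)); let A : Literature.Probability.LatticeModels.HexVertex := ((0 : Literature.Probability.LatticeModels.Site 2), (1 : Fin 2)); let B : Literature.Probability.LatticeModels.HexVertex := ((-(Pi.single 0 1) : Literature.Probability.LatticeModels.Site 2), (1 : Fin 2)); let C : Literature.Probability.LatticeModels.HexVertex := ((-(Pi.single 1 1) : Literature.Probability.LatticeModels.Site 2), (1 : Fin 2)); let F : Finset Literature.Probability.LatticeModels.HexVertex → Sym2 Literature.Probability.LatticeModels.HexVertex → Sym2 Literature.Probability.LatticeModels.HexVertex → ℂ := fun Λ a z => Literature.Probability.RandomPlanarGeometry.SAW.hexParafermionicObservable Λ a Literature.Probability.RandomPlanarGeometry.SAW.hexCriticalFugacity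 (5 / 8) z; let M : Finset Literature.Probability.LatticeModels.HexVertex → Sym2 Literature.Probability.LatticeModels.HexVertex → ℂ := fun Λ a => F Λ a s(O, A) + F Λ a s(O, B) + F Λ a s(O, C); let LocalLimits : Set (Sym2 Literature.Probability.LatticeModels.HexVertex → ℂ) := {G | (∀ z : Sym2 Literature.Probability.LatticeModels.HexVertex, z ∉ Literature.Probability.LatticeModels.hexGraph.edgeSet → G z = 0) ∧ ∃ (Λ : ℕ → Finset Literature.Probability.LatticeModels.HexVertex) (a : ℕ → Sym2 Literature.Probability.LatticeModels.HexVertex), (∀ n : ℕ, Literature.Probability.RandomPlanarGeometry.SAW.hexDomainSimplyConnected (Λ n) ∧ a n ∈ Literature.Probability.RandomPlanarGeometry.SAW.hexDomainBoundary (Λ n) ∧ ∀ w : Literature.Probability.LatticeModels.HexVertex, dist (Literature.Probability.LatticeModels.hexCenter w) (Literature.Probability.LatticeModels.hexCenter O) ≤ (n : ℝ) → w ∈ Λ n) ∧ (∀ n : ℕ, M (Λ n) (a n) ≠ 0) ∧ ∀ z ∈ Literature.Probability.LatticeModels.hexGraph.edgeSet, Filter.Tendsto (fun n : ℕ => F (Λ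 n) (a n) z / M (Λ n) (a n)) Filter.atTop (nhds (G z))}; LocalLimits.Subsingleton) : PicLimits.Subsingleton :=
  picLimits_subsingleton_of_localLimits_subsingleton (child_iff_defs.1 h)

/-- The child from the four registered stubs (documentation of closure; carries the four sorries). -/
theorem LocalLimitsUnique_of_stubs : (let O : Literature.Probability.LatticeModels.HexVertex := ((0 : Literature.Probability.LatticeModels.Site 2), (0 : Fin 2)); let A : Literature.Probability.LatticeModels.HexVertex := ((0 : Literature.Probability.LatticeModels.Site 2), (1 : Fin 2)); let B : Literature.Probability.LatticeModels.HexVertex := ((-(Pi.single 0 1) : Literature.Probability.LatticeModels.Site 2), (1 : Fin 2)); let C : Literature.Probability.LatticeModels.HexVertex := ((-(Pi.single 1 1) : Literature.Probability.LatticeModels.Site 2), (1 : Fin 2)); let F : Finset Literature.Probability.LatticeModels.HexVertex → Sym2 Literature.Probability.LatticeModels.HexVertex → Sym2 Literature.Probability.LatticeModels.HexVertex → ℂ := fun Λ a z => Literature.Probability.RandomPlanarGeometry.SAW.hexParafermionicObservable Λ a Literature.Probability.RandomPlanarGeometry.SAW.hexCriticalFugacity (5 / 8) z; let M : Finset Literature.Probability.LatticeModels.HexVertex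 → Sym2 Literature.Probability.LatticeModels.HexVertex → ℂ := fun Λ a => F Λ a s(O, A) + F Λ a s(O, B) + F Λ a s(O, C); let LocalLimits : Set (Sym2 Literature.Probability.LatticeModels.HexVertex → ℂ) := {G | (∀ z : Sym2 Literature.Probability.LatticeModels.HexVertex, z ∉ Literature.Probability.LatticeModels.hexGraph.edgeSet → G z = 0) ∧ ∃ (Λ : ℕ → Finset Literature.Probability.LatticeModels.HexVertex) (a : ℕ → Sym2 Literature.Probability.LatticeModels.HexVertex), (∀ n : ℕ, Literature.Probability.RandomPlanarGeometry.SAW.hexDomainSimplyConnected (Λ n) ∧ a n ∈ Literature.Probability.RandomPlanarGeometry.SAW.hexDomainBoundary (Λ n) ∧ ∀ w : Literature.Probability.LatticeModels.HexVertex, dist (Literature.Probability.LatticeModels.hexCenter w) (Literature.Probability.LatticeModels.hexCenter O) ≤ (n : ℝ) → w ∈ Λ n) ∧ (∀ n : ℕ, M (Λ n) (a n) ≠ 0) ∧ ∀ z ∈ Literature.Probability.LatticeModels.hexGraph.edgeSet, Filter.Tendsto (fun n : ℕ => F (Λ n) (a n) z / M (Λ n) (a n)) Filter.atTop (nhds (G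 z))}; LocalLimits.Subsingleton) :=
  LocalLimitsUnique_of stub_bulkNoFold stub_pictureLimitsUnique stub_farFieldCoherence stub_intrusionTail

end Summit.CriticalPhenomena.SAWScalingLimit.Cruxes.LocalLimitsUnique.Birth

end
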